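import Mathlib
import Literature.Combinatorics.SimpleGraph.TreeDecomposition
import Summits.ValiantsHypothesis.ValiantsHypothesis.Theorems.ProofCarryingSymmetryRestorationQPPolylogWidth
import Summits.ValiantsHypothesis.ValiantsHypothesis.Theorems.ProofCarryingSymmetryRestorationQPLineGlue
import Summits.ValiantsHypothesis.ValiantsHypothesis.Theorems.ProofCarryingSymmetryRestorationQPConsistency

/-!
# Strategy census s8 (independent, family `s`) for the crux `RestorationQP` — typed signatures

Companion to `Cruxes/RestorationQP/STRATEGY-CENSUS-s8.md` (planner, crux-strategist seat
`cstrat-stmt-ValiantsHypothesis-10343-s8`).  Every statement named in the census is typed here over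
existing declarations; the implications that are one-liners over tree theorems are PROVED (no `sorry`
anywhere); literature-level steps are NAMED FACTS (`def … : Prop`) with their source, never axioms.

What is proved here (all elementary glue over landed theorems):
* `restorationQP_iff` — the crux, unfolded against the local abbreviations;
* the SIZE AXIS: `RestorationQP → RestorationSubexp → ¬ ArithmeticCFI`, hence
  `RestorationSubexp → VP ≠ VNP` (`valiantsHypothesis_of_restorationSubexp`): the weakest conclusion the
  route's `closes` can use, symmetric size `2^{o(n)}`, still decides the summit; and
  `RestorationQP → RestorationSimplyExp` (size `2^{O(n)}`), the first statement on this axis that does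
  NOT (by Dawar–Wilsenach's `2^{Ω(n)}` bound for the permanent) imply the summit;
* the WIDTH AXIS: `RestorationQP → WidthLawVP → VP ≠ VNP` (re-exported) and the split
  `WidthLawVP → PolylogWidthRestorationQP → RestorationQP` whose first piece alone gives the summit;
* the FAMILY AXIS: `RestorationQP → HomRestorationQP` (restriction to single-pattern homomorphism
  families), with the literature fact `HighTreewidthHomSeparates` (Neuen 2024 / Roberson 2022 /
  Dawar–Richerby 2007) under which `HomRestorationQP` is an explicit VP lower bound schema;
* the NEGATION side: the Gram identity that restores symmetry of alternant pairs.
-/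

-- single-problem summit: `Summit.ValiantsHypothesis.ValiantsHypothesis.…` is the namespace by design (D-0017)
set_option linter.dupNamespace false

noncomputable section

open scoped Classical

namespace Summit.ValiantsHypothesis.ValiantsHypothesis.Cruxes.RestorationQP.StrategyCensusS8

open Filter
open Literature.Computability.AlgebraicComplexity
open Literature.ModelTheory.FiniteModelTheory
open Summit.ValiantsHypothesis.ValiantsHypothesis.Theses.ProofCarryingSymmetry (RestorationQP)
open Summit.ValiantsHypothesis.ValiantsHypothesis.Theorems

/-! ### Abbreviations -/

/-- Diagonal `S_n`-invariance of a family `f_n ∈ ℂ[x_ij : i, j < n]` (`x_ij ↦ x_{σ i, σ j}`). [folklore] -/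
def DiagInvariant (f : (n : ℕ) → MvPolynomial (Fin n × Fin n) ℂ) : Prop :=
  ∀ (n : ℕ) (σ : Equiv.Perm (Fin n)),
    MvPolynomial.rename (fun x : Fin n × Fin n => σ • x) (f n) = f n

/-- `p` has an `S_n`-symmetric labelled circuit with at most `s` gates (Dawar–Wilsenach circuits, as in the
crux). [cite: DawarWilsenach2025, §3] -/
def HasSymmCircuitOfSize (n : ℕ) (p : MvPolynomial (Fin n × Fin n) ℂ) (s : ℕ) : Prop :=
  ∃ (G : Type) (_ : Fintype G) (C : LabelledArithCircuit ℂ (Fin n × Fin n) Unit G),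
    C.IsSymmetric (Equiv.Perm (Fin n)) ∧ C.eval (C.output ()) = p ∧ Fintype.card G ≤ s

/-- Uniform polylogarithmic counting width of a family (values at `0/1` adjacency matrices agree on
`≡^{C^{(log₂ n + c')^{c'}}}`-equivalent graphs). [cite: DawarWilsenach2025, §6] -/
def PolylogWidth (f : (n : ℕ) → MvPolynomial (Fin n × Fin n) ℂ) : Prop :=
  ∃ c' : ℕ, ∀ (n : ℕ) (X Y : SimpleGraph (Fin n)),
    CkEquiv ((Nat.log 2 n + c') ^ c') X Y →
    MvPolynomial.eval (Set.indicator {ij : Fin n × Fin n | X.Adj ij.1 ij.2} 1) (f n) =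
      MvPolynomial.eval (Set.indicator {ij : Fin n × Fin n | Y.Adj ij.1 ij.2} 1) (f n)

/-- The crux, unfolded. [folklore] -/
theorem restorationQP_iff :
    RestorationQP ↔ ∀ f, DiagInvariant f → IsVPFamily f →
      ∃ c : ℕ, ∀ n, HasSymmCircuitOfSize n (f n) (2 ^ ((Nat.log 2 n + c) ^ c)) :=
  Iff.rfl

/-! ### 1. Weaker intermediates on the SIZE axis -/

/-- **W-size-1: sub-exponential restoration** — every diagonally invariant VP family has symmetric circuits
of size `2^{o(n)}` (for every `ε > 0`, eventually `≤ 2^{εn}`).  This is the weakest conclusion the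
Dawar–Wilsenach engine can still turn into `per ∉ VP`. [folklore] -/
def RestorationSubexp : Prop :=
  ∀ f, DiagInvariant f → IsVPFamily f →
    ∃ (G : ℕ → Type) (_ : ∀ n, Fintype (G n))
      (D : ∀ n, LabelledArithCircuit ℂ (Fin n × Fin n) Unit (G n)),
      (∀ n, (D n).IsSymmetric (Equiv.Perm (Fin n))) ∧
      (∀ n, (D n).eval ((D n).output ()) = f n) ∧
      ∀ ε : ℝ, 0 < ε → ∀ᶠ n : ℕ in atTop, (Fintype.card (G n) : ℝ) ≤ (2 : ℝ) ^ (ε * (n : ℝ))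

/-- `RestorationQP → RestorationSubexp` (quasi-polynomial is `2^{o(n)}`,
`natLog_add_pow_lt_mul_eventually`). [folklore] -/
theorem restorationSubexp_of_restorationQP : RestorationQP → RestorationSubexp := by
  intro hR f hinv hVP
  obtain ⟨c, hc⟩ := hR f hinv hVP
  choose G hG D hsym hev hcard using hc
  refine ⟨G, hG, D, hsym, hev, fun δ hδ => ?_⟩
  obtain ⟨n₀, hn₀⟩ :=
    Summit.ValiantsHypothesis.Theorems.ProofCarryingSymmetry.natLog_add_pow_lt_mul_eventually c hδ
  refine Filter.eventually_atTop.2 ⟨n₀, fun n hn => ?_⟩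
  calc (Fintype.card (G n) : ℝ) ≤ (2 : ℝ) ^ (((Nat.log 2 n + c) ^ c : ℕ) : ℝ) := by
        rw [Real.rpow_natCast]
        exact_mod_cast hcard n
    _ ≤ (2 : ℝ) ^ (δ * (n : ℝ)) := Real.rpow_le_rpow_of_exponent_le one_le_two (hn₀ n hn).le

/-- **`RestorationSubexp → ¬ ArithmeticCFI`**: the negative lemma `RestorationQP_false_of_ArithmeticCFI`
(p162481) only ever used the size bound `2^{o(n)}`; same proof. [cite: DawarWilsenach2025, §7.1 (proof of Thm. 7.1, p. 19)] -/
theorem not_arithmeticCFI_of_restorationSubexp : RestorationSubexp → ¬ ArithmeticCFI := by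
  rintro hR ⟨f, hinv, hVP, ε, hε, hfreq⟩
  obtain ⟨G, hG, D, hsym, hev, hsmall⟩ := hR f hinv hVP
  let val : ∀ n, SimpleGraph (Fin n) → ℂ := fun n Γ =>
    MvPolynomial.eval (fun ij : Fin n × Fin n => if Γ.Adj ij.1 ij.2 then (1 : ℂ) else 0) (f n)
  let P : ℕ → Prop := fun n => ∃ k : ℕ, ε * (n : ℝ) ≤ (k : ℝ) ∧
    ∃ X Y : SimpleGraph (Fin n), CkEquiv k X Y ∧ val n X ≠ val n Y
  have hP : ∃ᶠ n : ℕ in atTop, P n := hfreq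
  let X : ∀ n, SimpleGraph (Fin n) := fun n =>
    if h : P n then h.choose_spec.2.choose else ⊥
  have hmain := eval_adj_eq_eventually_of_isSymmetric_subexp f G D hsym hev hsmall X hε
  obtain ⟨n, hn, hPn⟩ := (hmain.and_frequently hP).exists
  have hXn : X n = hPn.choose_spec.2.choose := dif_pos hPn
  obtain ⟨Y, hXY, hne⟩ := hPn.choose_spec.2.choose_spec
  have heq := hn hPn.choose hPn.choose_spec.1 Y (hXn ▸ hXY)
  rw [hXn] at heq
  exact hne heq.symm

/-- **The weakest usable conclusion still decides the summit**: `RestorationSubexp → VP_ℂ ≠ VNP_ℂ`, through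
the unconditional dichotomy `arithmeticCFI_or_valiantsHypothesis` (p162999). [folklore] -/
theorem valiantsHypothesis_of_restorationSubexp : RestorationSubexp → _root_.ValiantsHypothesis :=
  fun h => arithmeticCFI_or_valiantsHypothesis.resolve_left (not_arithmeticCFI_of_restorationSubexp h)

/-- **W-size-2: simply-exponential restoration** — symmetric size `2^{O(n)}`.  The trivial orbit closure
gives `n! · poly = 2^{O(n log n)}`; Ryser's formula (for `per`) and Held–Karp tables (for Hamiltonian
cycles) are `S_n`-symmetric circuits of size `2^{O(n)}`, and Dawar–Wilsenach's `2^{Ω(n)}` lower bound for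
`per` shows this statement does NOT give `per ∉ VP`.  Counting-width lower bounds cannot refute it either
(width `≤ n` always).  Open; recorded as the one statement on the size axis strictly between the trivial
bound and the summit. [folklore] -/
def RestorationSimplyExp : Prop :=
  ∀ f, DiagInvariant f → IsVPFamily f →
    ∃ c : ℕ, ∀ n, HasSymmCircuitOfSize n (f n) (2 ^ (c * n + c))

/-- `RestorationQP → RestorationSimplyExp` (polylog `≤` linear, with a constant for small `n`). [folklore] -/
theorem restorationSimplyExp_of_restorationQP : RestorationQP → RestorationSimplyExp := by
  intro hR f hinv hVP
  obtain ⟨c, hc⟩ := hR f hinv hVP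
  obtain ⟨n₀, hn₀⟩ :=
    Summit.ValiantsHypothesis.Theorems.ProofCarryingSymmetry.natLog_add_pow_lt_mul_eventually c one_pos
  refine ⟨(Nat.log 2 n₀ + c) ^ c + 1, fun n => ?_⟩
  obtain ⟨G, hG, C, hsym, hev, hcard⟩ := hc n
  refine ⟨G, hG, C, hsym, hev, hcard.trans (Nat.pow_le_pow_right (by norm_num) ?_)⟩
  rcases Nat.lt_or_ge n n₀ with h | h
  · have hlog : Nat.log 2 n ≤ Nat.log 2 n₀ := Nat.log_mono_right h.le
    calc (Nat.log 2 n + c) ^ c ≤ (Nat.log 2 n₀ + c) ^ c :=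
          Nat.pow_le_pow_left (Nat.add_le_add_right hlog c) _
      _ ≤ (Nat.log 2 n₀ + c) ^ c + 1 := Nat.le_succ _
      _ ≤ ((Nat.log 2 n₀ + c) ^ c + 1) * n + ((Nat.log 2 n₀ + c) ^ c + 1) := Nat.le_add_left _ _
  · have h1 : (((Nat.log 2 n + c) ^ c : ℕ) : ℝ) < 1 * (n : ℝ) := hn₀ n h
    have h2 : (Nat.log 2 n + c) ^ c < n := by
      rw [one_mul] at h1
      exact_mod_cast h1
    calc (Nat.log 2 n + c) ^ c ≤ n := h2.le
      _ ≤ ((Nat.log 2 n₀ + c) ^ c + 1) * n := Nat.le_mul_of_pos_left n (Nat.succ_pos _)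
      _ ≤ ((Nat.log 2 n₀ + c) ^ c + 1) * n + ((Nat.log 2 n₀ + c) ^ c + 1) := Nat.le_add_right _ _

/-! ### 2. Weaker intermediates on the WIDTH axis -/

/-- **W-width: the width law** (landed glue, p166528): every diagonally invariant VP family has polylog
counting width. `RestorationQP → WidthLawVP → VH`; `WidthLawVP ↔`? `¬ArithmeticCFI` only `→` is known
(linear vs. polylog scale). [folklore] -/
def WidthLawVP : Prop := ∀ f, DiagInvariant f → IsVPFamily f → PolylogWidth f

theorem widthLawVP_of_restorationQP' : RestorationQP → WidthLawVP :=
  fun h f hs hV => widthLawVP_of_restorationQP h f hs hV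

theorem valiantsHypothesis_of_widthLawVP' : WidthLawVP → _root_.ValiantsHypothesis :=
  fun h => valiantsHypothesis_of_widthLawVP (fun f hs hV => h f hs hV)

theorem not_arithmeticCFI_of_widthLawVP' : WidthLawVP → ¬ ArithmeticCFI :=
  fun h => not_arithmeticCFI_of_widthLawVP (fun f hs hV => h f hs hV)

/-! ### 3. Decompositions -/

/-- **D2, second piece: restoration GIVEN polylog width.**  Semantic hypothesis (width) in place of the
syntactic VP structure; for single-pattern homomorphism families this is Dwivedi–Pago–Seppelt 2026
Thm. 3.4 at polylog scale (tree-decomposition dynamic programme of size `n^{O(tw)}`), in general open.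
[cite: DwivediPagoSeppelt2026, Thm. 3.4; conjecture-grade in general] -/
def PolylogWidthRestorationQP : Prop :=
  ∀ f, DiagInvariant f → IsVPFamily f → PolylogWidth f →
    ∃ c : ℕ, ∀ n, HasSymmCircuitOfSize n (f n) (2 ^ ((Nat.log 2 n + c) ^ c))

/-- **D2 assembly** `WidthLawVP → PolylogWidthRestorationQP → RestorationQP` (modus ponens).  NOT a
redirect in the BC2 sense: the first piece alone gives the summit (`valiantsHypothesis_of_widthLawVP'`).
[folklore] -/
theorem restorationQP_of_widthLaw_of_polylogWidthRestoration :
    WidthLawVP → PolylogWidthRestorationQP → RestorationQP :=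
  fun hW hP f hinv hVP => hP f hinv hVP (hW f hinv hVP)

/-- **D3, the trivial half of the degree split**: families of polylogarithmic degree have quasi-polynomial
SYMMETRIC circuits outright (the depth-2 monomial expansion of an invariant polynomial is an
`S_n`-symmetric circuit; `≤ (n²+1)^d` monomials, `d ≤ (log₂ n + a)^a`), no VP hypothesis needed.  So the
crux's content lives entirely in degrees `ω(polylog n)`.  [elementary; not formalised here] -/
def PolylogDegreeRestoration : Prop :=
  ∀ f, DiagInvariant f → (∃ a : ℕ, ∀ n, (f n).totalDegree ≤ (Nat.log 2 n + a) ^ a) →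
    ∃ c : ℕ, ∀ n, HasSymmCircuitOfSize n (f n) (2 ^ ((Nat.log 2 n + c) ^ c))

-- D1 = the registered line (T′ ∧ S2⁗), landed as p163213 / p157625:
#check @restorationQP_of_invarianceProvableQP'_of_proofsToDistEquiv
#check @restorationQP_iff_invarianceProvableQP'_of_proofsToDistEquiv

/-! ### 4. The FAMILY axis: single-pattern homomorphism families -/

/-- The homomorphism polynomial of a simple pattern `F` on `Fin j` in the `n × n` variable matrix:
`hom_{F,n} = ∑_{h : Fin j → Fin n} ∏_{u < v, F.Adj u v} x_{h u, h v}`.  At the `0/1` adjacency matrix of a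
graph `X` on `Fin n` it evaluates to `hom(F, X)`. [cite: DwivediPagoSeppelt2026, §3] -/
def homPolyOf {j : ℕ} (F : SimpleGraph (Fin j)) (n : ℕ) : MvPolynomial (Fin n × Fin n) ℂ :=
  ∑ h : Fin j → Fin n,
    ∏ e ∈ (Finset.univ.filter fun e : Fin j × Fin j => F.Adj e.1 e.2 ∧ e.1 < e.2),
      MvPolynomial.X (h e.1, h e.2)

/-- **W-family: the crux restricted to single-pattern homomorphism families** `n ↦ hom_{F_n, n}`.
[cite: DwivediPagoSeppelt2026, Thm. 3.4–Cor. 3.6] -/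
def HomRestorationQP : Prop :=
  ∀ (j : ℕ → ℕ) (F : ∀ n, SimpleGraph (Fin (j n))),
    DiagInvariant (fun n => homPolyOf (F n) n) → IsVPFamily (fun n => homPolyOf (F n) n) →
      ∃ c : ℕ, ∀ n, HasSymmCircuitOfSize n (homPolyOf (F n) n) (2 ^ ((Nat.log 2 n + c) ^ c))

/-- The restriction is literal. [folklore] -/
theorem homRestorationQP_of_restorationQP : RestorationQP → HomRestorationQP :=
  fun h _ F hinv hVP => h (fun n => homPolyOf (F n) n) hinv hVP

/-- **NAMED FACT (not formalised): high-treewidth patterns separate CFI pairs.**  For a connected pattern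
`F` with `tw(F) > k`, the even/odd CFI graphs over `F` — on `∑_v 2^{deg v - 1}` vertices, padded with
isolated vertices to any `n` at least that large — are `≡^{C^{k+1}}`-equivalent (Dawar–Richerby 2007;
Neuen 2024, Lemma 4.4) and receive different numbers of homomorphisms from `F` (Roberson 2022, Thm. 3.3,
the identity being a weak oddomorphism; Neuen 2024, proof of Thm. 1.2, p. 7).  With Dvořák's theorem
(`Dvorak2010_ckEquiv_iff_homCount_holds`, in tree) this is Neuen's homomorphism-distinguishing closedness
of bounded tree-width. [cite: Neuen2024 arXiv:2304.07011, Thm. 1.2 and §4.2; Roberson2022, Thm. 3.3] -/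
def HighTreewidthHomSeparates : Prop :=
  ∀ (j k : ℕ) (F : SimpleGraph (Fin j)), F.Connected →
    k < Literature.Combinatorics.SimpleGraph.treewidth F →
    ∀ n : ℕ, (∑ v : Fin j, 2 ^ F.degree v) ≤ n →
      ∃ X Y : SimpleGraph (Fin n), CkEquiv (k + 1) X Y ∧
        MvPolynomial.eval (Set.indicator {ij : Fin n × Fin n | X.Adj ij.1 ij.2} 1) (homPolyOf F n) ≠
          MvPolynomial.eval (Set.indicator {ij : Fin n × Fin n | Y.Adj ij.1 ij.2} 1) (homPolyOf F n)

/-- **The family-axis verdict, as a statement** (argument in the census, §1.3; not formalised):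
`HomRestorationQP → VP ≠ VNP`.  Sketch: take `F_n` = the `⌊√(n/8)⌋ × ⌊√(n/8)⌋` grid (connected, degree
`≤ 4`, `tw = ⌊√(n/8)⌋`, CFI pair on `≤ n` vertices); `hom_{F_n}` is in VNP (Valiant's criterion);
if it were in VP, `HomRestorationQP` and the in-tree engine `stub_fooling_of_qpSymmetric` would make it
`≡^{C^{polylog}}`-invariant at every order, contradicting `HighTreewidthHomSeparates` at large `n`; so
`hom_{F_n} ∉ VP`, an explicit VNP family outside VP. [argument; conjecture-free but not formalised] -/
def HomRestorationDecidesSummit : Prop := HomRestorationQP → _root_.ValiantsHypothesis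

/-! ### 5. Strengthenings (S⁺) -/

-- S⁺₁ = uniform polynomial restoration (in tree, p162012): implies the crux AND both open stubs.
#check @restorationQP_of_uniformRestoration
#check @proofsToDistEquiv_of_uniformRestoration

/-- **S⁺₂ / transfer to the GCT language: quasi-polynomial PERMUTATION-EQUIVARIANT determinantal
representations** (Dawar–Wilsenach's notion, ToC 2025 §7 before Cor. 7.12; Landsberg–Ressayre's
equivariant determinantal complexity restricted to permutation symmetry).  Symmetric Le Verrier on the
pencil should give `PermEquivariantDetQP → RestorationQP`; Valiant's universality construction applied to a
symmetric circuit is permutation-equivariant, so the converse is expected too: a reformulation of the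
crux with the same universal quantifier over undetermined VP circuits, not a weakening.
[cite: DawarWilsenach2025, Cor. 7.12; LandsbergRessayre2017; conjecture-grade] -/
def PermEquivariantDetQP : Prop :=
  ∀ f, DiagInvariant f → IsVPFamily f → ∃ c : ℕ, ∀ n, ∃ (m : ℕ)
    (M : Matrix (Fin m) (Fin m) (MvPolynomial (Fin n × Fin n) ℂ)),
    (∀ i j, (M i j).totalDegree ≤ 1) ∧ M.det = f n ∧
    (∀ σ : Equiv.Perm (Fin n), ∃ π : Equiv.Perm (Fin m),
      M.map (fun p => MvPolynomial.rename (fun x : Fin n × Fin n => σ • x) p) = M.submatrix π π) ∧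
    m ≤ 2 ^ ((Nat.log 2 n + c) ^ c)

/-! ### 6. Negation side: why alternant / semi-invariant amplifiers do not give an arithmetic CFI family -/

/-- **Gram restoration of alternant pairs.**  If `M₁, M₂` are only one-sidedly equivariant
(`σ • Mᵢ = P_σ Mᵢ`), each `det Mᵢ` is a mere semi-invariant (sign character), but the invariant product
is the determinant of the honestly (conjugation-)equivariant Gram matrix `M₁ᵀ M₂` — symmetric-easy by
Le Verrier.  Likewise `Pf(A) · det M = Pf(Mᵀ A M)` and `Pf(A) Pf(B) = Pf(A ⊕ B)` (the pfaffian-doubling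
card).  [folklore] -/
theorem det_mul_det_eq_det_gram {m : Type} [Fintype m] [DecidableEq m] {R : Type} [CommRing R]
    (M₁ M₂ : Matrix m m R) : M₁.det * M₂.det = (M₁.transpose * M₂).det := by
  rw [Matrix.det_mul, Matrix.det_transpose]

end Summit.ValiantsHypothesis.ValiantsHypothesis.Cruxes.RestorationQP.StrategyCensusS8

end
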